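import Literature.NumberTheory.EllipticCurves.IwasawaAlgebra
import Mathlib.Analysis.Complex.Basic
import HarnessLib

set_option autoImplicit false

/-!
# `𝒞₇` genus road (crux `EllipticUnitValueSevenOfGZK`, K7r), row (K2C-2) block (R), part 1: THE ABSTRACT ALGEBRA OF KATO'S
# RATIONAL COMPARISON — LEMMA S (rank-one separation, the censused shape), the module identity, the value identity, the
# transport through `ιS` and the final TWO-SIDED `(π^{m₀}·n₂) • EU = ((K₁K₂t′)·x) • zeta` / PERIOD-SCALED
# `π^{m₀+2j} • EU = ((v^{−j}w^{−1}c)·x) • zeta` forms with EXPLICIT constants (pen D911 (1)/D913), over arbitrary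
# rings/modules; plus three facts about `Λ = ℤ₇⟦X⟧` — THEOREMS ONLY (pure algebra; nothing asserted about any frame)

Cell bsd-cm, seat bsd-cm-prr-ty1 g30 (literature-prover), SUMMON `wake/SUMMON-bsd-cm-prr-ty1-20260830T1605Z.md`
(903ea518e552576d) block (R); pen D907/D908 ((SEP) census `g30/SepToy.lean` PASS).  Part 2
(`RamifiedSevenRationalComparisonOfInputs.lean`) instantiates these on a pinned frame.  The hypotheses of each lemma are
exactly what the frame-level proof supplies: a `Λ`-module `H` with an additive operator `piK` commuting with `Λ` and
`piK² = −7` (the CM operator), a dependence `s • E = r₀ • Z + r₁ • piK Z` (rank one over `Λ[piK]`), torsion-freeness, a value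
map `val : H →+ ℂ` semilinear through `ev : Λ → ℂ` with `piK ↦ q`, `q² = −7`, and the two value laws; the outputs are the
identities named in part 2's module docstring.  `Λ`-facts: `(n : Λ) ≠ 0` for `n ≠ 0`, `(k : Λ)` is a unit for `7 ∤ k`, and
`2N = (2N/7^{v₇ N})·7^{v₇ N}` with the first factor a unit (`two_mul_natCast_eq_unit_mul_pow`).  HONEST LABEL: algebra; no summit statement is touched; 19945 OPEN; BSD is
claimed for no curve.

References: K. Kato, Astérisque 295 (2004) (15.16.1) (p. 265), (15.12.2) (p. 263), 15.14 (p. 264), Thm. 12.4 (2) / 12.5 (1)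
(p. 221), §13.9 (p. 230) [Kato2004Asterisque]; L. C. Washington (1997) §7.1 [Washington1997]; CHECK (SEP) 2026-08-30.
-/

noncomputable section

open Polynomial
open Literature.NumberTheory.EllipticCurves

namespace Summit.BirchSwinnertonDyer.Rank1Residual.Additive.GenusSeven

/-! ## §1 The abstract algebra of the argument (LEMMA S and its concrete pieces) -/

section Abstract

/-- **LEMMA S (abstract rank-one separation; the shape censused in CHECK (SEP))**: over a commutative ring `R` acting on
`M`, with value maps `val i : M →+ B i` into domains, `R`-semilinear through `ev i`, scalars separated by almost all `ev i`
and `M` torsion-free: a non-degenerate dependence `s • x = ρ • z`, proportional values `ev c₂·val x = ev c₁·val z` a.e. and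
`val z ≠ 0` a.e. give `c₂ • x = c₁ • z`. [cite: Kato2004Asterisque, §13.9 (p. 230 l. 8–9) and Thm. 12.4 (2) (p. 221)] -/
theorem smul_eq_smul_of_values {R M : Type*} [CommRing R] [AddCommGroup M] [Module R M]
    {ι : Type*} {B : ι → Type*} [∀ i, CommRing (B i)] [∀ i, IsDomain (B i)]
    (ev : ∀ i, R →+* B i) (val : ∀ i, M →+ B i)
    (hval : ∀ i (r : R) (m : M), val i (r • m) = ev i r * val i m)
    (F : Filter ι) [F.NeBot]
    (hsep : ∀ r : R, (∀ᶠ i in F, ev i r = 0) → r = 0)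
    (htf : ∀ (r : R) (m : M), r ≠ 0 → r • m = 0 → m = 0)
    {x z : M} {s ρ c₁ c₂ : R} (hdep : s • x = ρ • z) (hs : s ≠ 0 ∨ ρ ≠ 0)
    (hvals : ∀ᶠ i in F, ev i c₂ * val i x = ev i c₁ * val i z)
    (hz : ∀ᶠ i in F, val i z ≠ 0) : c₂ • x = c₁ • z := by
  have hdepv : ∀ i, ev i s * val i x = ev i ρ * val i z := fun i => by
    rw [← hval, ← hval, hdep]
  have hs0 : s ≠ 0 := by
    rcases hs with h | hρ
    · exact h
    · intro h0
      apply hρ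
      apply hsep
      filter_upwards [hz] with i hzi
      have := hdepv i
      rw [h0, map_zero, zero_mul] at this
      exact (mul_eq_zero.mp this.symm).resolve_right hzi
  have hsc : c₂ * ρ = s * c₁ := by
    rw [← sub_eq_zero]
    apply hsep
    filter_upwards [hvals, hz] with i hvi hzi
    have h1 : ev i c₂ * (ev i s * val i x) = ev i s * (ev i c₁ * val i z) := by
      rw [← hvi]; ring
    rw [hdepv i] at h1
    have h2 : (ev i (c₂ * ρ - s * c₁)) * val i z = 0 := by
      rw [map_sub, map_mul, map_mul]; linear_combination h1
    exact (mul_eq_zero.mp h2).resolve_right hzi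
  have h3 : s • (c₂ • x - c₁ • z) = 0 := by
    rw [smul_sub, smul_comm, hdep, ← mul_smul, hsc, mul_smul, sub_self]
  exact sub_eq_zero.mp (htf s _ hs0 h3)

variable {Λ : Type*} [CommRing Λ] {H : Type*} [AddCommGroup H] [Module Λ H]

/-- `s = 0` is impossible in the dependence: the two scalar identities with `s = 0` force `r₀ = r₁ = 0`
(`(α₀² + 7α₁²)·r_i = 0` in the domain `Λ`). [cite: Kato2004Asterisque, Thm. 12.4 (2) (p. 221)] -/
theorem r_eq_zero_of_s_eq_zero [IsDomain Λ] {r₀ r₁ P : Λ} {c₁ N2 b₀ b₁ α₀ α₁ : ℤ}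
    (h2 : (2 : Λ) ≠ 0) (hN : ((α₀ ^ 2 + 7 * α₁ ^ 2 : ℤ) : Λ) ≠ 0)
    (G0 : (c₁ : Λ) * 0 * ((N2 : Λ) - (b₀ : Λ) * P) = 2 * ((α₀ : Λ) * r₀ - ((7 * α₁ : ℤ) : Λ) * r₁))
    (G1 : -((c₁ : Λ) * (b₁ : Λ) * 0 * P) = 2 * ((α₁ : Λ) * r₀ + (α₀ : Λ) * r₁)) :
    r₀ = 0 ∧ r₁ = 0 := by
  have e0 : (α₀ : Λ) * r₀ = 7 * (α₁ : Λ) * r₁ := by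
    have : 2 * ((α₀ : Λ) * r₀ - 7 * (α₁ : Λ) * r₁) = 0 := by push_cast at G0; linear_combination -G0
    rcases mul_eq_zero.mp this with h | h
    · exact absurd h h2
    · exact sub_eq_zero.mp h
  have e1 : (α₁ : Λ) * r₀ = -((α₀ : Λ) * r₁) := by
    have : 2 * ((α₁ : Λ) * r₀ + (α₀ : Λ) * r₁) = 0 := by linear_combination -G1
    rcases mul_eq_zero.mp this with h | h
    · exact absurd h h2
    · exact eq_neg_of_add_eq_zero_left h
  have k0 : ((α₀ ^ 2 + 7 * α₁ ^ 2 : ℤ) : Λ) * r₀ = 0 := by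
    push_cast
    linear_combination (α₀ : Λ) * e0 + (7 * (α₁ : Λ)) * e1
  have k1 : ((α₀ ^ 2 + 7 * α₁ ^ 2 : ℤ) : Λ) * r₁ = 0 := by
    push_cast
    linear_combination (-(α₁ : Λ)) * e0 + (α₀ : Λ) * e1
  exact ⟨(mul_eq_zero.mp k0).resolve_left hN, (mul_eq_zero.mp k1).resolve_left hN⟩

/-- **The MODULE identity**: from the dependence `s • E = r₀ • Z + r₁ • piK Z` (`s ≠ 0`), `piK² = −7`, torsion-freeness and
the two scalar identities `G0`, `G1` (= «`7^e s x̃ = 2αρ` in `Λ[piK]`»): `2(α₀² + 7α₁²) • E = ᾱ·(7^e x̃) • Z`.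
[cite: Kato2004Asterisque, (15.16.1) (p. 265) with Thm. 12.4 (2) (p. 221)] -/
theorem module_identity (piK : H →+ H) (hpiK_smul : ∀ (f : Λ) (y : H), piK (f • y) = f • piK y)
    (hpiK_sq : ∀ y, piK (piK y) = ((-7 : ℤ) : Λ) • y)
    (htf : ∀ (f : Λ) (x : H), f ≠ 0 → f • x = 0 → x = 0)
    {s r₀ r₁ P : Λ} {E Z : H} (hs : s ≠ 0) (hdep : s • E = r₀ • Z + r₁ • piK Z)
    {c₁ N2 b₀ b₁ α₀ α₁ : ℤ}
    (G0 : (c₁ : Λ) * s * ((N2 : Λ) - (b₀ : Λ) * P) = 2 * ((α₀ : Λ) * r₀ - ((7 * α₁ : ℤ) : Λ) * r₁))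
    (G1 : -((c₁ : Λ) * (b₁ : Λ) * s * P) = 2 * ((α₁ : Λ) * r₀ + (α₀ : Λ) * r₁)) :
    ((2 * (α₀ ^ 2 + 7 * α₁ ^ 2) : ℤ) : Λ) • E =
      (α₀ : Λ) • ((c₁ : Λ) • (((N2 : Λ) - (b₀ : Λ) * P) • Z) - ((c₁ : Λ) * (b₁ : Λ)) • (P • piK Z))
        - (α₁ : Λ) • piK ((c₁ : Λ) • (((N2 : Λ) - (b₀ : Λ) * P) • Z) - ((c₁ : Λ) * (b₁ : Λ)) • (P • piK Z)) := by
  have piK_add : ∀ x y : H, piK (x + y) = piK x + piK y := fun x y => map_add piK x y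
  have h1 : s • ((c₁ : Λ) • (((N2 : Λ) - (b₀ : Λ) * P) • Z) - ((c₁ : Λ) * (b₁ : Λ)) • (P • piK Z)) =
      (2 : Λ) • ((α₀ : Λ) • (s • E) + (α₁ : Λ) • piK (s • E)) := by
    rw [hdep, piK_add, hpiK_smul, hpiK_smul, hpiK_sq]
    push_cast at G0 G1 ⊢
    linear_combination (norm := module) G0 • Z + G1 • piK Z
  have h2 : s • (((c₁ : Λ) • (((N2 : Λ) - (b₀ : Λ) * P) • Z) - ((c₁ : Λ) * (b₁ : Λ)) • (P • piK Z)) -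
      (2 : Λ) • ((α₀ : Λ) • E + (α₁ : Λ) • piK E)) = 0 := by
    rw [smul_sub, h1, hpiK_smul]
    module
  have h3 := sub_eq_zero.mp (htf s _ hs h2)
  rw [h3]
  simp only [smul_add, piK_add, hpiK_smul, hpiK_sq]
  push_cast
  module

/-- The complex identity behind the key step (values of the dependence + the two value laws + `2ψ(𝔟) = b₀ + b₁√−7` +
`(√−7)² = −7`). [cite: Kato2004Asterisque, (15.12.2) (p. 263) and (15.16.1) (p. 265)] -/
theorem key_complex_identity {S R0 R1 q w V VE M Ψ : ℂ} {N : ℕ} {c₁ b₀ b₁ α₀ α₁ : ℤ}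
    (hq : q ^ 2 = -7) (hdv : S * VE = R0 * V + q * (R1 * V))
    (hE : VE = ((N : ℂ) - Ψ * w) * M) (hZ : (c₁ : ℂ) * V = ((α₀ : ℂ) + (α₁ : ℂ) * q) * M)
    (hΨ : 2 * Ψ = (b₀ : ℂ) + (b₁ : ℂ) * q) :
    (((c₁ : ℂ) * S * ((2 * N : ℕ) - (b₀ : ℂ) * w) - 2 * ((α₀ : ℂ) * R0 - (7 * α₁ : ℂ) * R1)) * V +
      q * ((-((c₁ * b₁ : ℂ) * S * w) - 2 * ((α₁ : ℂ) * R0 + (α₀ : ℂ) * R1)) * V)) * M = 0 := by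
  push_cast
  linear_combination ((c₁ : ℂ) * S * w * V * M) * hΨ + (-(2 * (c₁ : ℂ) * S * V)) * hE + (2 * (c₁ : ℂ) * V) * hdv
    + (2 * V * (R0 + q * R1)) * hZ + (2 * (α₁ : ℂ) * R1 * V * M) * hq

/-- **The VALUE identity**: with a `Λ`-semilinear value map `val` (through `ev`), `piK` acting by `q = √−7`, the value laws for
`E` and `Z` and `val Z ≠ 0`: `ev(g₀² + 7g₁²) = 0` for the two explicit elements `g₀, g₁ ∈ Λ` of the module docstring.
[cite: Kato2004Asterisque, (15.16.1) (p. 265), (15.12.2) (p. 263), Thm. 12.5 (1) (p. 221)] -/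
theorem ev_normForm_eq_zero (piK : H →+ H) (val : H →+ ℂ) (ev : Λ → ℂ)
    (hval : ∀ (f : Λ) (m : H), val (f • m) = ev f * val m)
    (hpiK_smul : ∀ (f : Λ) (y : H), piK (f • y) = f • piK y)
    {q : ℂ} (hq : q ^ 2 = -7) (hvpi : ∀ y, val (piK y) = q * val y)
    (hint : ∀ (c : ℤ) (m : H), val ((c : Λ) • m) = c * val m)
    {P : Λ} {w : ℂ} (hP : ∀ m, val (P • m) = w * val m)
    {s r₀ r₁ : Λ} {E Z : H} (hdep : s • E = r₀ • Z + r₁ • piK Z)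
    {N : ℕ} {Ψ M : ℂ} {c₁ b₀ b₁ α₀ α₁ : ℤ}
    (hE : val E = ((N : ℂ) - Ψ * w) * M) (hZ : (c₁ : ℂ) * val Z = ((α₀ : ℂ) + (α₁ : ℂ) * q) * M)
    (hΨ : 2 * Ψ = (b₀ : ℂ) + (b₁ : ℂ) * q) (hM : M ≠ 0) (hV : val Z ≠ 0)
    {g₀ g₁ : Λ}
    (hg₀ : g₀ = (c₁ : Λ) * s * (((2 * N : ℕ) : ℤ) - (b₀ : Λ) * P) - 2 * ((α₀ : Λ) * r₀ - ((7 * α₁ : ℤ) : Λ) * r₁))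
    (hg₁ : g₁ = -((c₁ : Λ) * (b₁ : Λ) * s * P) - 2 * ((α₁ : Λ) * r₀ + (α₀ : Λ) * r₁)) :
    ev (g₀ * g₀ + ((7 : ℤ) : Λ) * (g₁ * g₁)) = 0 := by
  have hdv : ev s * val E = ev r₀ * val Z + q * (ev r₁ * val Z) := by
    have := congrArg val hdep
    rwa [hval, map_add, hval, ← hpiK_smul, hvpi, hval] at this
  have hval' : ∀ (f g : Λ) (m : H), val ((f * g) • m) = ev f * val (g • m) := fun f g m => by
    rw [mul_smul, hval]
  have hg₀v : val (g₀ • Z) = ((c₁ : ℂ) * ev s * ((2 * N : ℕ) - (b₀ : ℂ) * w) -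
      2 * ((α₀ : ℂ) * ev r₀ - (7 * α₁ : ℂ) * ev r₁)) * val Z := by
    have e1 : val (g₀ • Z) = (c₁ : ℂ) * (ev s * ((((2 * N : ℕ) : ℤ) : ℂ) * val Z - (b₀ : ℂ) * (w * val Z))) -
        (2 : ℤ) * ((α₀ : ℂ) * (ev r₀ * val Z) - ((7 * α₁ : ℤ) : ℂ) * (ev r₁ * val Z)) := by
      rw [hg₀, sub_smul, map_sub, mul_smul, mul_smul, hint, hval, sub_smul, map_sub, hint, mul_smul, hint, hP,
        show (2 : Λ) = ((2 : ℤ) : Λ) by norm_num, mul_smul, hint, sub_smul, map_sub, mul_smul, hint, hval,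
        mul_smul, hint, hval]
    rw [e1]; push_cast; ring
  have hg₁v : val (g₁ • Z) = (-((c₁ * b₁ : ℂ) * ev s * w) - 2 * ((α₁ : ℂ) * ev r₀ + (α₀ : ℂ) * ev r₁)) * val Z := by
    have e1 : val (g₁ • Z) = -((c₁ : ℂ) * ((b₁ : ℂ) * (ev s * (w * val Z)))) -
        (2 : ℤ) * ((α₁ : ℂ) * (ev r₀ * val Z) + (α₀ : ℂ) * (ev r₁ * val Z)) := by
      rw [hg₁, sub_smul, map_sub, neg_smul, map_neg, mul_smul, mul_smul, mul_smul, hint, hint, hval, hP,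
        show (2 : Λ) = ((2 : ℤ) : Λ) by norm_num, mul_smul, hint, add_smul, map_add, mul_smul, hint, hval,
        mul_smul, hint, hval]
    rw [e1]; push_cast; ring
  have key : val (g₀ • Z) + q * val (g₁ • Z) = 0 := by
    have h := key_complex_identity (S := ev s) (R0 := ev r₀) (R1 := ev r₁) hq hdv hE hZ hΨ
    rw [hg₀v, hg₁v]
    rcases mul_eq_zero.mp h with h | h
    · exact h
    · exact absurd h hM
  have hev : ev g₀ * val Z = -(q * (ev g₁ * val Z)) := by
    rw [← hval, ← hval]; exact eq_neg_of_add_eq_zero_left key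
  have hev' : ev g₀ = -(q * ev g₁) := by
    apply mul_right_cancel₀ hV; rw [hev]; ring
  have e7 : val ((g₀ * g₀ + ((7 : ℤ) : Λ) * (g₁ * g₁)) • Z) = (ev g₀ * ev g₀ + 7 * (ev g₁ * ev g₁)) * val Z := by
    rw [add_smul, map_add, hval', hval, mul_smul, hint, hval', hval]; push_cast; ring
  have e8 : val ((g₀ * g₀ + ((7 : ℤ) : Λ) * (g₁ * g₁)) • Z) = 0 := by
    rw [e7, hev']
    have : (-(q * ev g₁) * -(q * ev g₁) + 7 * (ev g₁ * ev g₁)) = (q ^ 2 + 7) * (ev g₁ * ev g₁) := by ring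
    rw [this, hq]; ring
  rw [hval] at e8
  rcases mul_eq_zero.mp e8 with h | h
  · exact h
  · exact absurd h hV

variable {R A : Type*} [CommRing R] [Algebra Λ R] [AddCommGroup A] [Module R A] [Module Λ A] [IsScalarTower Λ R A]

/-- **Transport through `ιS`** (`Λ`-linear, `ιS ∘ piK = π • ιS`): `ιS (ᾱ·T • Z) = C • ιS Z` with the explicit `C ∈ R`.
[cite: Kato2004Asterisque, 15.14 (p. 264)] -/
theorem iotaS_transport (ιS : H →ₗ[Λ] A) (π : R) (piK : H →+ H) (hιS_piK : ∀ y, ιS (piK y) = π • ιS y)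
    (hpiK_smul : ∀ (f : Λ) (y : H), piK (f • y) = f • piK y) (α₀ α₁ c₁ b₁ Q P : Λ) (Z : H) :
    ιS (α₀ • (c₁ • (Q • Z) - (c₁ * b₁) • (P • piK Z)) - α₁ • piK (c₁ • (Q • Z) - (c₁ * b₁) • (P • piK Z))) =
      (((algebraMap Λ R α₀ - algebraMap Λ R α₁ * π) * algebraMap Λ R c₁) *
        (algebraMap Λ R Q - algebraMap Λ R b₁ * algebraMap Λ R P * π)) • ιS Z := by
  simp only [map_sub, map_smul, hpiK_smul, map_sub piK, hιS_piK, mul_smul]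
  module

/-- `ιS Z` from the unit relation `u • Z ↦ j z₁ = 7^k u_R π^a zS`. [cite: Kato2004Asterisque, Thm. 12.5 (1) (p. 221) and 15.14 (p. 264)] -/
theorem iotaS_eq_of_unit_smul (ιS : H →ₗ[Λ] A) (π : R) {Z : H} {jz zS : A} (u : Λˣ) (hu : ιS ((u : Λ) • Z) = jz)
    (k a : ℕ) (uR : Rˣ) (hjz : jz = ((7 : Λ) ^ k) • ((uR : R) • π ^ a • zS)) :
    ιS Z = (algebraMap Λ R (↑(u⁻¹) : Λ) * (algebraMap Λ R ((7 : Λ) ^ k) * ((uR : R) * π ^ a))) • zS := by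
  have h1 : (algebraMap Λ R (u : Λ)) • ιS Z = (algebraMap Λ R ((7 : Λ) ^ k) * ((uR : R) * π ^ a)) • zS := by
    rw [algebraMap_smul, ← map_smul, hu, hjz, ← algebraMap_smul (R := Λ) R ((7 : Λ) ^ k), smul_smul, smul_smul,
      mul_assoc]
  have hw : algebraMap Λ R (↑(u⁻¹) : Λ) * algebraMap Λ R (u : Λ) = 1 := by
    rw [← map_mul, Units.inv_mul, map_one]
  calc ιS Z = (algebraMap Λ R (↑(u⁻¹) : Λ) * algebraMap Λ R (u : Λ)) • ιS Z := by rw [hw, one_smul]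
    _ = algebraMap Λ R (↑(u⁻¹) : Λ) • (algebraMap Λ R (u : Λ) • ιS Z) := mul_smul _ _ _
    _ = _ := by rw [h1, smul_smul]

/-- **The TWO-SIDED exact form** (pen D911 (1)/D913): from `n₂ • EU = ((K₁·x)·K₂) • zS`, `zeta = t • zS` and
`t·t′ = π^{m₀}`: `(π^{m₀}·n₂) • EU = ((K₁·K₂·t′)·x) • zeta` — both constants explicit. [cite: Kato2004Asterisque, (15.16.1) (p. 265)] -/
theorem twoSided_of_smul_eq (π : R) {EU zS zeta : A} {t t' : R} {m₀ : ℕ} (K₁ x K₂ : R) (n2 : Λ)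
    (hzeta : zeta = t • zS) (ht : t * t' = π ^ m₀) (h : n2 • EU = ((K₁ * x) * K₂) • zS) :
    (π ^ m₀ * algebraMap Λ R n2) • EU = ((K₁ * K₂ * t') * x) • zeta := by
  rw [mul_smul, algebraMap_smul, h, hzeta, smul_smul, smul_smul, ← ht]
  congr 1
  ring

/-- **The PERIOD-SCALED exact form** from the two-sided one: with `n₂ = w·7^j` (`w ∈ Λˣ`) and `7 = v·π²` on `A`,
`π^{m₀ + 2j} • EU = ((v^{−j}·w^{−1}·c)·x) • zeta`. [cite: Kato2004Asterisque, (15.16.1) (p. 265)] -/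
theorem periodScaled_of_twoSided (π : R) {EU zeta : A} {m₀ j : ℕ} (v : Rˣ) (w : Λˣ) (c x : R) (n2 : Λ)
    (hn2 : n2 = (w : Λ) * (7 : Λ) ^ j) (h7 : ∀ y : A, (7 : Λ) • y = ((v : R) * π ^ 2) • y)
    (h : (π ^ m₀ * algebraMap Λ R n2) • EU = (c * x) • zeta) :
    π ^ (m₀ + 2 * j) • EU = ((((↑(v⁻¹) : R) ^ j * algebraMap Λ R (↑(w⁻¹) : Λ)) * c) * x) • zeta := by
  have h7R : ∀ y : A, (7 : R) • y = ((v : R) * π ^ 2) • y := by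
    intro y; rw [← h7, ← algebraMap_smul (R := Λ) R (7 : Λ) y, map_ofNat]
  have h7j : ∀ (i : ℕ) (y : A), ((7 : R) ^ i) • y = (((v : R) * π ^ 2) ^ i) • y := by
    intro i
    induction i with
    | zero => intro y; simp
    | succ i ih => intro y; rw [pow_succ (7 : R) i, mul_smul, h7R, ih, smul_smul, ← pow_succ]
  have h1 : algebraMap Λ R n2 • EU = (algebraMap Λ R (w : Λ) * ((v : R) * π ^ 2) ^ j) • EU := by
    rw [hn2, map_mul, map_pow, map_ofNat, mul_smul, h7j, smul_smul]
  have h2 : (π ^ m₀ * (algebraMap Λ R (w : Λ) * ((v : R) * π ^ 2) ^ j)) • EU = (c * x) • zeta := by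
    rw [mul_smul, ← h1, ← mul_smul]; exact h
  have hw : algebraMap Λ R (↑(w⁻¹) : Λ) * algebraMap Λ R (w : Λ) = 1 := by
    rw [← map_mul, Units.inv_mul, map_one]
  have hv : ((↑(v⁻¹) : R) ^ j) * (v : R) ^ j = 1 := by
    rw [← mul_pow, Units.inv_mul, one_pow]
  have h3 : π ^ (m₀ + 2 * j) = ((↑(v⁻¹) : R) ^ j * algebraMap Λ R (↑(w⁻¹) : Λ)) *
      (π ^ m₀ * (algebraMap Λ R (w : Λ) * ((v : R) * π ^ 2) ^ j)) := by
    calc π ^ (m₀ + 2 * j) = π ^ m₀ * (π ^ 2) ^ j * (((↑(v⁻¹) : R) ^ j) * (v : R) ^ j) *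
          (algebraMap Λ R (↑(w⁻¹) : Λ) * algebraMap Λ R (w : Λ)) := by rw [hv, hw]; ring
      _ = _ := by ring
  calc π ^ (m₀ + 2 * j) • EU
      = (((↑(v⁻¹) : R) ^ j * algebraMap Λ R (↑(w⁻¹) : Λ)) *
          (π ^ m₀ * (algebraMap Λ R (w : Λ) * ((v : R) * π ^ 2) ^ j))) • EU := by rw [h3]
    _ = ((↑(v⁻¹) : R) ^ j * algebraMap Λ R (↑(w⁻¹) : Λ)) •
          ((π ^ m₀ * (algebraMap Λ R (w : Λ) * ((v : R) * π ^ 2) ^ j)) • EU) := mul_smul _ _ _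
    _ = ((↑(v⁻¹) : R) ^ j * algebraMap Λ R (↑(w⁻¹) : Λ)) • ((c * x) • zeta) := by rw [h2]
    _ = _ := by rw [smul_smul]; congr 1; ring

end Abstract

/-! ## §2 Two facts about `Λ = ℤ₇⟦X⟧` -/

/-- A non-zero integer is non-zero in `Λ = ℤ₇⟦X⟧`. [cite: Washington1997, §7.1] -/
theorem intCast_iwasawaAlgebra_ne_zero [Fact (Nat.Prime 7)] {n : ℤ} (hn : n ≠ 0) : (n : IwasawaAlgebra 7) ≠ 0 := by
  rw [← map_intCast (PowerSeries.C (R := ℤ_[7])), Ne, ← map_zero (PowerSeries.C (R := ℤ_[7])),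
    (PowerSeries.C_injective).eq_iff]
  exact_mod_cast hn

/-- An integer prime to `7` is a unit of `Λ = ℤ₇⟦X⟧`. [cite: Washington1997, §7.1] -/
theorem isUnit_intCast_iwasawaAlgebra_of_not_dvd [Fact (Nat.Prime 7)] {k : ℤ} (hk : ¬ (7 : ℤ) ∣ k) :
    IsUnit ((k : IwasawaAlgebra 7)) := by
  have h1 : IsUnit ((k : ℤ_[7])) := by
    rw [PadicInt.isUnit_iff]
    have hle := PadicInt.norm_le_one ((k : ℤ_[7]))
    have hlt : ¬ ‖((k : ℤ_[7]))‖ < 1 := by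
      rw [PadicInt.norm_int_lt_one_iff_dvd]; exact_mod_cast hk
    exact le_antisymm hle (not_lt.mp hlt)
  have := h1.map (PowerSeries.C (R := ℤ_[7]))
  rwa [map_intCast] at this

/-- `2N = (2·ordCompl₇ N)·7^{v₇(N)}` in `Λ` with the first factor a unit (`N ≠ 0`). [cite: Washington1997, §7.1 (Λ local with residue field 𝔽_p)] -/
theorem two_mul_natCast_eq_unit_mul_pow [Fact (Nat.Prime 7)] {N : ℕ} (hN : N ≠ 0) :
    IsUnit ((2 * (N / 7 ^ N.factorization 7) : ℕ) : IwasawaAlgebra 7) ∧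
      ((2 * N : ℕ) : IwasawaAlgebra 7) =
        ((2 * (N / 7 ^ N.factorization 7) : ℕ) : IwasawaAlgebra 7) * (7 : IwasawaAlgebra 7) ^ N.factorization 7 := by
  have hm7 : ¬ 7 ∣ N / 7 ^ N.factorization 7 := Nat.not_dvd_ordCompl Fact.out hN
  refine ⟨?_, ?_⟩
  · have h : ¬ (7 : ℤ) ∣ ((2 * (N / 7 ^ N.factorization 7) : ℕ) : ℤ) := by
      intro h7
      have h7' : (7 : ℕ) ∣ 2 * (N / 7 ^ N.factorization 7) := by exact_mod_cast h7
      rcases (Nat.Prime.dvd_mul (Fact.out : Nat.Prime 7)).mp h7' with h | h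
      · omega
      · exact hm7 h
    have hu := isUnit_intCast_iwasawaAlgebra_of_not_dvd h
    rwa [Int.cast_natCast] at hu
  · have hfac : 2 * N = 2 * (N / 7 ^ N.factorization 7) * 7 ^ N.factorization 7 := by
      conv_lhs => rw [← Nat.ordProj_mul_ordCompl_eq_self N 7]
      ring
    rw [hfac, Nat.cast_mul, Nat.cast_pow, Nat.cast_ofNat]

end Summit.BirchSwinnertonDyer.Rank1Residual.Additive.GenusSeven

end
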